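import Literature.NumberTheory.Automorphic.GKCohomologyFunctor
import HarnessLib

/-!
# `H^q(𝔤, K; −)` is additive in the morphism

Topic `NumberTheory/Automorphic`; namespace `Literature.NumberTheory.Automorphic`.  Theorems only,
complementing `GKCohomologyFunctor` (`gkCohomologyHom`, functor laws `_id`, `_comp`, `_zero`):
`gkCohomologyHom_congr` (the induced map depends only on the linear map, not on the equivariance
proofs), `gkCohomologyHom_add`, `gkCohomologyHom_sum` (with `sum_comm𝔤`, `sum_commK`),
`gkCohomologyHom_smul_left` — `H^q(T₁ + T₂) = H^q(T₁) + H^q(T₂)`, `H^q(∑ Tᵢ) = ∑ H^q(Tᵢ)`,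
`H^q(c T) = c H^q(T)`.  Needed to compute Hecke operators `∑ᵢ H^q(r(gᵢ))` on the
`(𝔤, K_∞)`-cohomology of automorphic representations as `H^q` of the finite sum of translations
(Eichler–Shimura–Harder comparison, Harder 1987, §3).  Borel–Wallach I §1.2 (functoriality of
relative Lie algebra cohomology in the coefficient module).

## References
* [BorelWallach2000] A. Borel, N. Wallach, *Continuous cohomology, discrete subgroups, and
  representations of reductive groups*, 2nd ed., AMS 2000, I §1.2, §5.1.
-/

noncomputable section

namespace Literature.NumberTheory.Automorphic

open Module Literature.Algebra.Lie

attribute [local instance 100] LieRing.ofAssociativeRing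

variable {A : Type*} [NormedCommRing A] [NormedAlgebra ℝ A] [NormedAlgebra ℚ A] [CompleteSpace A]
  [StarRing A] [StarModule ℝ A] {N : Type*} [Fintype N] [DecidableEq N] (G : RealMatrixGroup A N)
  {V : Type*} [AddCommGroup V] [Module ℂ V]
  (ρK : Representation ℂ G.maximalCompact V) (ρ𝔤 : G.lie →ₗ⁅ℝ⁆ Module.End ℂ V)
  {W : Type*} [AddCommGroup W] [Module ℂ W]
  (σK : Representation ℂ G.maximalCompact W) (σ𝔤 : G.lie →ₗ⁅ℝ⁆ Module.End ℂ W)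
  (had : ∀ (k : G.maximalCompact) (X : G.lie),
    ρK k ∘ₗ ρ𝔤 X ∘ₗ ρK k⁻¹ = ρ𝔤 (G.Ad (Subgroup.inclusion G.maximalCompact_le_carrier k) X))
  (had' : ∀ (k : G.maximalCompact) (X : G.lie),
    σK k ∘ₗ σ𝔤 X ∘ₗ σK k⁻¹ = σ𝔤 (G.Ad (Subgroup.inclusion G.maximalCompact_le_carrier k) X))

/-- **`H^q(T)` only depends on `T`** (the equivariance proofs are irrelevant), and equal maps
induce equal maps. [folklore] -/
theorem gkCohomologyHom_congr {T T' : V →ₗ[ℂ] W} (h : T = T')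
    (hT𝔤 : ∀ X : G.lie, T ∘ₗ ρ𝔤 X = σ𝔤 X ∘ₗ T) (hTK : ∀ k : G.maximalCompact, T ∘ₗ ρK k = σK k ∘ₗ T)
    (hT'𝔤 : ∀ X : G.lie, T' ∘ₗ ρ𝔤 X = σ𝔤 X ∘ₗ T')
    (hT'K : ∀ k : G.maximalCompact, T' ∘ₗ ρK k = σK k ∘ₗ T') (q : ℕ) :
    gkCohomologyHom G ρK ρ𝔤 σK σ𝔤 had had' T hT𝔤 hTK q =
      gkCohomologyHom G ρK ρ𝔤 σK σ𝔤 had had' T' hT'𝔤 hT'K q := by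
  subst h
  rfl

/-- **Additivity of `H^q` in the morphism**: `H^q(T₁ + T₂) = H^q(T₁) + H^q(T₂)`.
[cite: BorelWallach2000, I §1.2] -/
theorem gkCohomologyHom_add (T₁ T₂ : V →ₗ[ℂ] W)
    (h₁𝔤 : ∀ X : G.lie, T₁ ∘ₗ ρ𝔤 X = σ𝔤 X ∘ₗ T₁) (h₁K : ∀ k : G.maximalCompact, T₁ ∘ₗ ρK k = σK k ∘ₗ T₁)
    (h₂𝔤 : ∀ X : G.lie, T₂ ∘ₗ ρ𝔤 X = σ𝔤 X ∘ₗ T₂) (h₂K : ∀ k : G.maximalCompact, T₂ ∘ₗ ρK k = σK k ∘ₗ T₂)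
    (h𝔤 : ∀ X : G.lie, (T₁ + T₂) ∘ₗ ρ𝔤 X = σ𝔤 X ∘ₗ (T₁ + T₂))
    (hK : ∀ k : G.maximalCompact, (T₁ + T₂) ∘ₗ ρK k = σK k ∘ₗ (T₁ + T₂)) (q : ℕ)
    (x : gkCohomology G ρK ρ𝔤 had q) :
    gkCohomologyHom G ρK ρ𝔤 σK σ𝔤 had had' (T₁ + T₂) h𝔤 hK q x =
      gkCohomologyHom G ρK ρ𝔤 σK σ𝔤 had had' T₁ h₁𝔤 h₁K q x +
        gkCohomologyHom G ρK ρ𝔤 σK σ𝔤 had had' T₂ h₂𝔤 h₂K q x := by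
  obtain ⟨z, rfl⟩ := (gkComplex G ρK ρ𝔤 had).toCohomology_surjective q x
  simp only [gkCohomologyHom_apply,
    ChevalleyEilenberg.Subcomplex.IsCochainMapTo.cohomologyMap_toCohomology, ← map_add]
  congr 1

omit [StarModule ℝ A] in
/-- Sums commute with the `𝔤`-actions when the summands do. [folklore] -/
theorem sum_comm𝔤 {ι : Type*} (s : Finset ι) (T : ι → V →ₗ[ℂ] W)
    (h𝔤 : ∀ i X, T i ∘ₗ ρ𝔤 X = σ𝔤 X ∘ₗ T i) (X : G.lie) :
    (∑ i ∈ s, T i) ∘ₗ ρ𝔤 X = σ𝔤 X ∘ₗ ∑ i ∈ s, T i := by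
  refine LinearMap.ext fun v => ?_
  simp only [LinearMap.comp_apply, LinearMap.sum_apply, map_sum]
  exact Finset.sum_congr rfl fun i _ => LinearMap.congr_fun (h𝔤 i X) v

omit [StarModule ℝ A] in
/-- Sums commute with the `K`-actions when the summands do. [folklore] -/
theorem sum_commK {ι : Type*} (s : Finset ι) (T : ι → V →ₗ[ℂ] W)
    (hK : ∀ i k, T i ∘ₗ ρK k = σK k ∘ₗ T i) (k : G.maximalCompact) :
    (∑ i ∈ s, T i) ∘ₗ ρK k = σK k ∘ₗ ∑ i ∈ s, T i := by
  refine LinearMap.ext fun v => ?_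
  simp only [LinearMap.comp_apply, LinearMap.sum_apply, map_sum]
  exact Finset.sum_congr rfl fun i _ => LinearMap.congr_fun (hK i k) v

/-- **`H^q` of a finite sum of `(𝔤, K)`-maps is the sum of the `H^q`.** [cite: BorelWallach2000, I §1.2] -/
theorem gkCohomologyHom_sum {ι : Type*} (s : Finset ι) (T : ι → V →ₗ[ℂ] W)
    (h𝔤 : ∀ i X, T i ∘ₗ ρ𝔤 X = σ𝔤 X ∘ₗ T i) (hK : ∀ i k, T i ∘ₗ ρK k = σK k ∘ₗ T i)
    (hs𝔤 : ∀ X : G.lie, (∑ i ∈ s, T i) ∘ₗ ρ𝔤 X = σ𝔤 X ∘ₗ ∑ i ∈ s, T i)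
    (hsK : ∀ k : G.maximalCompact, (∑ i ∈ s, T i) ∘ₗ ρK k = σK k ∘ₗ ∑ i ∈ s, T i) (q : ℕ)
    (x : gkCohomology G ρK ρ𝔤 had q) :
    gkCohomologyHom G ρK ρ𝔤 σK σ𝔤 had had' (∑ i ∈ s, T i) hs𝔤 hsK q x =
      ∑ i ∈ s, gkCohomologyHom G ρK ρ𝔤 σK σ𝔤 had had' (T i) (h𝔤 i) (hK i) q x := by
  classical
  induction s using Finset.induction_on with
  | empty =>
    conv_rhs => rw [Finset.sum_empty]
    have h0 : (∑ i ∈ (∅ : Finset ι), T i) = 0 := Finset.sum_empty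
    rw [gkCohomologyHom_congr G ρK ρ𝔤 σK σ𝔤 had had' h0 hs𝔤 hsK
      (fun _ => by rw [LinearMap.zero_comp, LinearMap.comp_zero])
      (fun _ => by rw [LinearMap.zero_comp, LinearMap.comp_zero]) q]
    exact gkCohomologyHom_zero G ρK ρ𝔤 σK σ𝔤 had had' q x
  | insert i s hi ih =>
    conv_rhs => rw [Finset.sum_insert hi]
    have hins : (∑ j ∈ insert i s, T j) = T i + ∑ j ∈ s, T j := Finset.sum_insert hi
    have hs𝔤' := sum_comm𝔤 G ρ𝔤 σ𝔤 s T h𝔤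
    have hsK' := sum_commK G ρK σK s T hK
    have hi𝔤 : ∀ X : G.lie, (T i + ∑ j ∈ s, T j) ∘ₗ ρ𝔤 X = σ𝔤 X ∘ₗ (T i + ∑ j ∈ s, T j) := by
      rw [← hins]; exact hs𝔤
    have hiK : ∀ k : G.maximalCompact,
        (T i + ∑ j ∈ s, T j) ∘ₗ ρK k = σK k ∘ₗ (T i + ∑ j ∈ s, T j) := by
      rw [← hins]; exact hsK
    rw [gkCohomologyHom_congr G ρK ρ𝔤 σK σ𝔤 had had' hins hs𝔤 hsK hi𝔤 hiK q,
      gkCohomologyHom_add G ρK ρ𝔤 σK σ𝔤 had had' (T i) (∑ j ∈ s, T j) (h𝔤 i) (hK i) hs𝔤' hsK'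
        hi𝔤 hiK, ih hs𝔤' hsK']

/-- **Homogeneity**: `H^q(c • T) = c • H^q(T)`. [cite: BorelWallach2000, I §1.2] -/
theorem gkCohomologyHom_smul_left (c : ℂ) (T : V →ₗ[ℂ] W)
    (hT𝔤 : ∀ X : G.lie, T ∘ₗ ρ𝔤 X = σ𝔤 X ∘ₗ T) (hTK : ∀ k : G.maximalCompact, T ∘ₗ ρK k = σK k ∘ₗ T)
    (hc𝔤 : ∀ X : G.lie, (c • T) ∘ₗ ρ𝔤 X = σ𝔤 X ∘ₗ (c • T))
    (hcK : ∀ k : G.maximalCompact, (c • T) ∘ₗ ρK k = σK k ∘ₗ (c • T)) (q : ℕ)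
    (x : gkCohomology G ρK ρ𝔤 had q) :
    gkCohomologyHom G ρK ρ𝔤 σK σ𝔤 had had' (c • T) hc𝔤 hcK q x =
      c • gkCohomologyHom G ρK ρ𝔤 σK σ𝔤 had had' T hT𝔤 hTK q x := by
  obtain ⟨z, rfl⟩ := (gkComplex G ρK ρ𝔤 had).toCohomology_surjective q x
  rw [gkCohomologyHom_apply, gkCohomologyHom_apply,
    ChevalleyEilenberg.Subcomplex.IsCochainMapTo.cohomologyMap_toCohomology,
    ChevalleyEilenberg.Subcomplex.IsCochainMapTo.cohomologyMap_toCohomology,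
    ← ChevalleyEilenberg.Subcomplex.toCohomology_smul]
  · congr 1
  · exact ((isCochainMapTo_hom G ρK ρ𝔤 σK σ𝔤 had had' (c • T) hc𝔤 hcK).cocyclesMap q z).2

end Literature.NumberTheory.Automorphic

end
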